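import Summits.BirchSwinnertonDyer.BirchSwinnertonDyer.Theorems.ResidualThetaTransportAtTwoResidualSignedLambdaLowerCMAtTwoRhoLayerPairingGlueAwayTwo
import HarnessLib

/-!
# GLUE package T2 (a): the `ℤ₂`-module structure on `D_w = H¹(ℚ_{∞,w̃}, A_ρ)` THROUGH the functorial scalar action `DlocSMul`
# (so that the split texts' binder `[Module ℤ_[2] (Dloc …)]` + pin `AwayPins.hD` / `AtTwoPins.hD₂` are instantiated by `rfl`)

Route `ResidualThetaTransportAtTwo` (RTT), crux RSL_g `ResidualSignedLambdaLowerCMAtTwo` (stmt-BirchSwinnertonDyer-22608); LEAD `prover-bsd-wall-rtt-p2` g18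
(`--supports 22608 --as helper`, closes nothing). One DEFINITION (a `Module` structure as a `def`, NOT an `instance` — the assembly uses it with `letI`)
and its unfolding lemma; the module axioms are the functoriality of `H¹` in the coefficient morphism (`cohomologyMap` of `cofreeLocalScalar`), proved on
cocycles. GLUE-SPEC-g18 §1 T2 (a). BSD is not proved by any of this.

* `DlocSMul_oneCocycleClass` — `a • [ψ] = [a • ψ]` on cocycles; `DlocSMul_one`, `DlocSMul_mul`, `DlocSMul_add` — functoriality/additivity in `a`.
* **`dlocModule S κ ρ w : Module ℤ_[2] (Dloc S κ ρ w)`**, `a • y := DlocSMul w (padicIntToCoeffIntegers S a) y`; `dlocModule_smul_def` (`rfl`).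

References: [SerreGaloisCohomology1997] I §2.2; [Greenberg1989] §1 p. 98; [Kato2004Asterisque] §13.8.
-/

set_option autoImplicit false
-- the Theorems namespace of this sub repeats the summit name by design (D-0017 nested layout)
set_option linter.dupNamespace false

noncomputable section

open scoped Classical

namespace Summit.BirchSwinnertonDyer.BirchSwinnertonDyer.Theorems.OnePair

open CategoryTheory Field NumberField IsDedekindDomain
  Literature.NumberTheory.EllipticCurves Literature.NumberTheory.GaloisRepresentations
  Literature.NumberTheory.EllipticCurves.GreenbergSelmer Literature.NumberTheory.EllipticCurves.CyclotomicLayer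
  Summit.BirchSwinnertonDyer.BirchSwinnertonDyer.Theorems.ThetaTransport

variable (S : Set (PadicAlgCl 2)) (κ : ZpExtension ℚ 2) (ρ : FramedGaloisRep ℚ ↥(padicCoeffIntegers S) 2) (w : HeightOneSpectrum (𝓞 ℚ))

/-- **`DlocSMul` on cocycles**: `a • [ψ] = [g ↦ a • ψ g]` (`cohomologyMap` of `cofreeLocalScalar a` restricted to `U_{∞,w}`, on an explicit cocycle).
[cite: SerreGaloisCohomology1997, I §2.2] -/
theorem DlocSMul_oneCocycleClass (a : ↥(padicCoeffIntegers S))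
    (ψ : contOneCocycles (subgroupRep (localRepOf (cofreeGaloisModule S ρ) w) (kerGroup κ w))) :
    DlocSMul S κ ρ w a (oneCocycleClass _ ψ) =
      oneCocycleClass (subgroupRep (localRepOf (cofreeGaloisModule S ρ) w) (kerGroup κ w))
        (contOneCocycles.pullback (ContinuousMonoidHom.id _)
          (resIdHom (subgroupRepMap (Y := localRepOf (cofreeGaloisModule S ρ) w) (cofreeLocalScalar S ρ a w) (kerGroup κ w))) ψ) := by
  unfold DlocSMul
  exact cohomologyMap_oneCocycleClass _ ψ

/-- The values of that cocycle: `(a • ψ) g = a • ψ g`. [cite: SerreGaloisCohomology1997, I §2.2] -/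
theorem DlocSMul_cocycle_apply (a : ↥(padicCoeffIntegers S))
    (ψ : contOneCocycles (subgroupRep (localRepOf (cofreeGaloisModule S ρ) w) (kerGroup κ w))) (g : ↥(kerGroup κ w)) :
    (contOneCocycles.pullback (ContinuousMonoidHom.id _)
          (resIdHom (subgroupRepMap (Y := localRepOf (cofreeGaloisModule S ρ) w) (cofreeLocalScalar S ρ a w) (kerGroup κ w))) ψ).1 g =
      a • ψ.1 g :=
  rfl

/-- `1 • y = y` for `DlocSMul`. [cite: SerreGaloisCohomology1997, I §2.2] -/
theorem DlocSMul_one (y : Dloc S κ ρ w) : DlocSMul S κ ρ w 1 y = y := by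
  obtain ⟨ψ, rfl⟩ := oneCocycleClass_surjective _ y
  rw [DlocSMul_oneCocycleClass]
  exact congrArg _ (Subtype.ext (ContinuousMap.ext fun g ↦ (DlocSMul_cocycle_apply S κ ρ w 1 ψ g).trans (one_smul _ _)))

/-- `(a * b) • y = a • (b • y)` for `DlocSMul`. [cite: SerreGaloisCohomology1997, I §2.2] -/
theorem DlocSMul_mul (a b : ↥(padicCoeffIntegers S)) (y : Dloc S κ ρ w) :
    DlocSMul S κ ρ w (a * b) y = DlocSMul S κ ρ w a (DlocSMul S κ ρ w b y) := by
  obtain ⟨ψ, rfl⟩ := oneCocycleClass_surjective _ y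
  rw [DlocSMul_oneCocycleClass, DlocSMul_oneCocycleClass, DlocSMul_oneCocycleClass]
  exact congrArg _ (Subtype.ext (ContinuousMap.ext fun g ↦ by
    rw [DlocSMul_cocycle_apply, DlocSMul_cocycle_apply, DlocSMul_cocycle_apply, mul_smul]))

/-- `(a + b) • y = a • y + b • y` for `DlocSMul`. [cite: SerreGaloisCohomology1997, I §2.2] -/
theorem DlocSMul_add (a b : ↥(padicCoeffIntegers S)) (y : Dloc S κ ρ w) :
    DlocSMul S κ ρ w (a + b) y = DlocSMul S κ ρ w a y + DlocSMul S κ ρ w b y := by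
  obtain ⟨ψ, rfl⟩ := oneCocycleClass_surjective _ y
  rw [DlocSMul_oneCocycleClass, DlocSMul_oneCocycleClass, DlocSMul_oneCocycleClass, ← oneCocycleClass_add]
  exact congrArg _ (Subtype.ext (ContinuousMap.ext fun g ↦ by
    rw [DlocSMul_cocycle_apply]
    change (a + b) • ψ.1 g = a • ψ.1 g + b • ψ.1 g
    exact add_smul a b _))

/-- `0 • y = 0` for `DlocSMul`. [cite: SerreGaloisCohomology1997, I §2.2] -/
theorem DlocSMul_zero (y : Dloc S κ ρ w) : DlocSMul S κ ρ w 0 y = 0 := by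
  have h := DlocSMul_add S κ ρ w 0 0 y
  rw [add_zero] at h
  exact left_eq_add.mp h

/-- **The `ℤ₂`-module structure on `D_w` through the functorial scalar action** (a `def`, not an instance; the assembly installs it with
`letI` and then `AwayPins.hD` / `AtTwoPins.hD₂` hold by `rfl`): `a • y := DlocSMul w (padicIntToCoeffIntegers S a) y`.
[cite: Greenberg1989, §1 p. 98] [cite: Kato2004Asterisque, §13.8 (p. 228)] -/
@[reducible] def dlocModule : Module ℤ_[2] (Dloc S κ ρ w) where
  smul a y := DlocSMul S κ ρ w (padicIntToCoeffIntegers S a) y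
  one_smul y := by
    change DlocSMul S κ ρ w (padicIntToCoeffIntegers S 1) y = y
    rw [map_one, DlocSMul_one]
  mul_smul a b y := by
    change DlocSMul S κ ρ w (padicIntToCoeffIntegers S (a * b)) y =
      DlocSMul S κ ρ w (padicIntToCoeffIntegers S a) (DlocSMul S κ ρ w (padicIntToCoeffIntegers S b) y)
    rw [map_mul, DlocSMul_mul]
  smul_zero a := map_zero (DlocSMul S κ ρ w (padicIntToCoeffIntegers S a))
  smul_add a y y' := map_add (DlocSMul S κ ρ w (padicIntToCoeffIntegers S a)) y y'
  add_smul a b y := by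
    change DlocSMul S κ ρ w (padicIntToCoeffIntegers S (a + b)) y =
      DlocSMul S κ ρ w (padicIntToCoeffIntegers S a) y + DlocSMul S κ ρ w (padicIntToCoeffIntegers S b) y
    rw [map_add, DlocSMul_add]
  zero_smul y := by
    change DlocSMul S κ ρ w (padicIntToCoeffIntegers S 0) y = 0
    rw [map_zero, DlocSMul_zero]

/-- Unfolding the scalar action of `dlocModule`: it IS `DlocSMul` (so `AwayPins.hD` / `AtTwoPins.hD₂` are `rfl` for it). [cite: Greenberg1989, §1 p. 98] -/
theorem dlocModule_smul_def (a : ℤ_[2]) (y : Dloc S κ ρ w) :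
    (letI := dlocModule S κ ρ w; a • y) = DlocSMul S κ ρ w (padicIntToCoeffIntegers S a) y :=
  rfl

end Summit.BirchSwinnertonDyer.BirchSwinnertonDyer.Theorems.OnePair

end
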